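import Mathlib
import Literature.AlgebraicGeometry.Resolution.SmoothOfRegularPerfectField
import Summits.ResolutionOfSingularities.ResolutionOfSingularities.Theorems.WeightedInvariantDefs
import Summits.ResolutionOfSingularities.ResolutionOfSingularities.Theorems.WeightedInvariantDatumToEmbeddedQuotientSingularitiesGraded
import Summits.ResolutionOfSingularities.ResolutionOfSingularities.Theorems.WeightedInvariantDatumToEmbeddedQuotientBaseGraded
import Summits.ResolutionOfSingularities.ResolutionOfSingularities.Theorems.WeightedInvariantDatumToEmbeddedAtlasLemmas
import HarnessLib

/-!
# The base case of the cobordant tower: étale quotient charts from the slice core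

Topic: `Summits/ResolutionOfSingularities/ResolutionOfSingularities/Theorems`. Stub `stub_qs_base`
of the line `Sketch` of the crux `Theses.WeightedInvariant.DatumToEmbedded` (statement
`stmt-ResolutionOfSingularities-0572`) of the summit
`Summit.ResolutionOfSingularities.ResolutionOfSingularities`.

Setting: a torus-quotient presentation `𝒜 : GradedAtlas j f i q`
(`Theorems/WeightedInvariantDefs.lean`) of the closed subscheme `i : X ⟶ Y` over `f : Y ⟶ Spec k`
by `q : X ⟶ V`; on a chart `a`: `A = Γ(Y, W a)` graded by `𝒜.piece a`, `R = Γ(X, X ∩ W a)`,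
`C = Γ(V, U a)`, `π = i♯ : A ↠ R` (closed immersion), `ψ = q♯ : C ↪ R` with image `π(A₀)`.

* Structure maps: for a `k`-scheme `h : Z ⟶ Spec k` the ring map
  `k ≅ Γ(Spec k, ⊤) → Γ(Z, U)` is `((ΓSpecIso k).inv ≫ h.appLE ⊤ U _).hom`; it is compatible with
  `appLE` of `k`-morphisms (`appLE_comp_structureMap`), smooth on affine opens of a smooth `Z`
  (`smooth_structureMap`, Mathlib `Smooth.smooth_appLE`), and `fromSpec ≫ h` is its `Spec`
  (`fromSpec_comp_eq`).
* `exists_eq_of_mem`, `surjective` — **the quotient map `q` is surjective**: a point `v ∈ U a`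
  is a prime of `C ≅ R₀`, contracted from a prime of `R` by degree-zero lying over
  (`…QuotientBaseGraded`), i.e. the image of a point of the affine chart `X ∩ W a ≅ Spec R`
  (Mathlib `IsAffineOpen.SpecMap_appLE_fromSpec`); `fromSpec_eq_of_comap` — a prime `y` of `C`
  with `y = ψ⁻¹(𝔭ₓ)` IS the point `q x` (Mathlib `IsAffineOpen.comap_primeIdealOf_appLE`).
* `exists_etale_quotientChart` / `stub_qs_base` — **from the slice core to étale quotient
  charts**: if `X` is regular, every `v ∈ V` lies in the image of an étale `k`-morphism
  `Spec S₀ ⟶ V` with `S` a finite-abelian-group-graded smooth finite-type `k`-algebra (the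
  hypothesis shape of `BerghRydh2019_diagonalizableQuotientResolution`): pick `x₁ ↦ v` and a closed
  point `x₀ ∈ closure {x₁}` of the quasi-compact `X`; on the chart of `𝒜.exists_unit x₀`, `R` is
  a graded smooth `k`-algebra (image grading; `X` regular over the perfect `k` ⇒ smooth,
  `smooth_of_isRegular_of_perfectField`) with units in all degrees `e • χ`; the slice core at the
  maximal ideal of `x₀` gives `R₀ → S₀` étale with a prime over `x₀`, and
  `φ := Spec S₀ → Spec R₀ ≅ Spec C ≅ U a ⊆ V` is étale with open image containing
  `q x₀ ∈ closure {v}`, hence `v`; the structure maps agree because `q ≫ g = i ≫ f`.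
  (Włodarczyk, arXiv:2203.03090, p. 3: "the geometric quotient has abelian quotient
  singularities" — folklore glue, the Zariski form of Luna's slice for diagonalizable groups.)

Only Mathlib, the `Defs` file, `Literature/…/SmoothOfRegularPerfectField` and the sibling helper
files are used; no definitions are published. [folklore]
-/

noncomputable section

-- the summit namespace repeats `ResolutionOfSingularities` by design (mandated namespace)
set_option linter.dupNamespace false

namespace Summit.ResolutionOfSingularities.ResolutionOfSingularities.Theorems.DatumToEmbedded.QuotientBase

open CategoryTheory AlgebraicGeometry TopologicalSpace DirectSum
open Literature.AlgebraicGeometry.Resolution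
open Summit.ResolutionOfSingularities.ResolutionOfSingularities.Theorems.DatumToEmbedded.QuotientSingularities

/-! ## Structure maps on sections of a `k`-scheme -/

section Sections

variable {k : Type} [Field k]

/-- Compatibility of the structure maps `k ≅ Γ(Spec k, ⊤) → Γ(Z, U)` with a `k`-morphism
`g : Z' ⟶ Z`: `g♯ ∘ (k → Γ(Z, U)) = (k → Γ(Z', V))` for `V ⊆ g⁻¹ U`. [folklore] -/
theorem appLE_comp_structureMap {Z' Z : Scheme.{0}} (g : Z' ⟶ Z) (h : Z ⟶ Spec (.of k))
    (U : Z.Opens) (V : Z'.Opens) (e : V ≤ g ⁻¹ᵁ U) :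
    (g.appLE U V e).hom.comp ((Scheme.ΓSpecIso (.of k)).inv ≫ h.appLE ⊤ U le_top).hom =
      ((Scheme.ΓSpecIso (.of k)).inv ≫ (g ≫ h).appLE ⊤ V le_top).hom := by
  rw [← CommRingCat.hom_comp, Category.assoc, Scheme.Hom.appLE_comp_appLE]

/-- The same for `g.app U`. [folklore] -/
theorem app_comp_structureMap {Z' Z : Scheme.{0}} (g : Z' ⟶ Z) (h : Z ⟶ Spec (.of k))
    (U : Z.Opens) :
    (g.app U).hom.comp ((Scheme.ΓSpecIso (.of k)).inv ≫ h.appLE ⊤ U le_top).hom =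
      ((Scheme.ΓSpecIso (.of k)).inv ≫ (g ≫ h).appLE ⊤ (g ⁻¹ᵁ U) le_top).hom := by
  rw [Scheme.Hom.app_eq_appLE, appLE_comp_structureMap]

/-- **Sections of a smooth `k`-scheme over an affine open form a smooth `k`-algebra.**
[folklore] -/
theorem smooth_structureMap {Z : Scheme.{0}} (h : Z ⟶ Spec (.of k)) [Smooth h] {U : Z.Opens}
    (hU : IsAffineOpen U) : ((Scheme.ΓSpecIso (.of k)).inv ≫ h.appLE ⊤ U le_top).hom.Smooth :=
  (RingHom.Smooth.respectsIso.cancel_left_isIso _ _).mpr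
    (h.smooth_appLE (isAffineOpen_top _) hU le_top)

/-- `fromSpec ≫ h` for an affine open of a `k`-scheme is `Spec` of the structure map.
[folklore] -/
theorem fromSpec_comp_eq {Z : Scheme.{0}} (h : Z ⟶ Spec (.of k)) {U : Z.Opens}
    (hU : IsAffineOpen U) :
    hU.fromSpec ≫ h = Spec.map ((Scheme.ΓSpecIso (.of k)).inv ≫ h.appLE ⊤ U le_top) := by
  rw [← IsAffineOpen.SpecMap_appLE_fromSpec h (isAffineOpen_top _) hU le_top,
    IsAffineOpen.fromSpec_top, Scheme.isoSpec_Spec_inv, ← Spec.map_comp]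

end Sections

/-! ## The quotient map of a graded atlas is surjective -/

section Chart

variable {k : Type} [Field k] {Y X V : Scheme.{0}} {f : Y ⟶ Spec (.of k)} {i : X ⟶ Y}
  [IsClosedImmersion i] {q : X ⟶ V} {j : ℕ} (𝒜 : GradedAtlas j f i q)

/-- `i♯ : Γ(Y, W a) → Γ(X, X ∩ W a)` is surjective. [folklore] -/
theorem app_surjective (a : 𝒜.ι) : Function.Surjective (i.app (𝒜.W a)).hom :=
  i.app_surjective _ (𝒜.W a).2

/-- The kernel of `i♯` on the chart is homogeneous. [folklore] -/
theorem isHomogeneous_ker (a : 𝒜.ι) :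
    letI := 𝒜.gradedRing a
    (RingHom.ker (i.app (𝒜.W a)).hom).IsHomogeneous (𝒜.piece a) := by
  have h := 𝒜.isHomogeneous_ker a
  rwa [Scheme.Hom.ker_apply] at h

/-- `q♯` takes values in the image of the degree-`0` piece … [folklore] -/
theorem appLE_mem_map (a : 𝒜.ι) (c : Γ(V, 𝒜.U a)) :
    q.appLE (𝒜.U a) (i ⁻¹ᵁ (𝒜.W a)) (𝒜.preimage_eq a).le c ∈
      (𝒜.piece a 0).map (i.app (𝒜.W a)).hom.toAddMonoidHom := by
  obtain ⟨s, hs, e⟩ := 𝒜.exists_lift a c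
  exact ⟨s, hs, e.symm⟩

/-- … and onto it. [folklore] -/
theorem exists_appLE_eq (a : 𝒜.ι) :
    ∀ x ∈ (𝒜.piece a 0).map (i.app (𝒜.W a)).hom.toAddMonoidHom,
      ∃ c, q.appLE (𝒜.U a) (i ⁻¹ᵁ (𝒜.W a)) (𝒜.preimage_eq a).le c = x := by
  rintro _ ⟨s, hs, rfl⟩
  exact 𝒜.exists_preimage a s hs

/-- **Points of the chart map onto `U a`**: every `v ∈ U a` is `q x` for some `x ∈ X ∩ W a`
(degree-zero lying over for `C ≅ R₀ ⊆ R`, then `Spec R ≅ X ∩ W a`). [folklore] -/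
theorem exists_eq_of_mem (a : 𝒜.ι) {v : V} (hv : v ∈ (𝒜.U a : V.Opens)) :
    ∃ x : X, x ∈ i ⁻¹ᵁ (𝒜.W a : Y.Opens) ∧ q x = v := by
  letI := 𝒜.gradedRing a
  obtain ⟨gr, -⟩ := exists_gradedRing_map (𝒜.piece a) (i.app (𝒜.W a)).hom (app_surjective 𝒜 a)
    (isHomogeneous_ker 𝒜 a)
  let y := (𝒜.U a).2.primeIdealOf ⟨v, hv⟩
  obtain ⟨Q, hQ, hQy⟩ := exists_isPrime_comap_eq_of_degreeZero
    (fun χ => (𝒜.piece a χ).map (i.app (𝒜.W a)).hom.toAddMonoidHom) (appLE_mem_map 𝒜 a)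
    (exists_appLE_eq 𝒜 a) (𝒜.appLE_injective a) y.asIdeal
  have hU₀ := Atlas.isAffineOpen_preimage_W 𝒜 a
  refine ⟨hU₀.fromSpec ⟨Q, hQ⟩, ?_, ?_⟩
  · have := hU₀.range_fromSpec ▸ Set.mem_range_self (f := hU₀.fromSpec) ⟨Q, hQ⟩
    exact this
  · rw [← Scheme.Hom.comp_apply, ← IsAffineOpen.SpecMap_appLE_fromSpec q (𝒜.U a).2 hU₀
      (𝒜.preimage_eq a).le, Scheme.Hom.comp_apply]
    have h2 : Spec.map (q.appLE (𝒜.U a) (i ⁻¹ᵁ (𝒜.W a)) (𝒜.preimage_eq a).le) ⟨Q, hQ⟩ = y :=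
      PrimeSpectrum.ext hQy
    rw [h2]
    exact (𝒜.U a).2.fromSpec_primeIdealOf ⟨v, hv⟩

include 𝒜 in
/-- **The quotient map of a graded atlas is surjective.** [folklore; Mumford, GIT, Thm 1.1] -/
theorem surjective : Function.Surjective q := fun v => by
  have hv : v ∈ (⊤ : V.Opens) := trivial
  rw [← 𝒜.iSup_eq_top, Opens.mem_iSup] at hv
  obtain ⟨a, ha⟩ := hv
  obtain ⟨x, -, hx⟩ := exists_eq_of_mem 𝒜 a ha
  exact ⟨x, hx⟩

/-- **Points through primes.** If a prime `y` of `C = Γ(V, U a)` is the contraction along `q♯`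
of the prime of a point `x ∈ X ∩ W a`, then `y` is the point `q x`. [folklore] -/
theorem fromSpec_eq_of_comap (a : 𝒜.ι) {x : X} (hx : x ∈ i ⁻¹ᵁ (𝒜.W a : Y.Opens))
    (y : PrimeSpectrum Γ(V, 𝒜.U a))
    (hy : y.asIdeal = ((Atlas.isAffineOpen_preimage_W 𝒜 a).primeIdealOf ⟨x, hx⟩).asIdeal.comap
      (q.appLE (𝒜.U a) (i ⁻¹ᵁ (𝒜.W a)) (𝒜.preimage_eq a).le).hom) :
    (𝒜.U a).2.fromSpec y = q x := by
  have h : y = (𝒜.U a).2.primeIdealOf ⟨q x, (𝒜.preimage_eq a).le hx⟩ := by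
    rw [← IsAffineOpen.comap_primeIdealOf_appLE (𝒜.U a : V.Opens) (𝒜.U a).2 _
      (Atlas.isAffineOpen_preimage_W 𝒜 a) (𝒜.preimage_eq a).le hx]
    exact PrimeSpectrum.ext hy
  rw [h]
  exact (𝒜.U a).2.fromSpec_primeIdealOf ⟨q x, _⟩

end Chart

/-! ## The base case: étale quotient charts from the slice core -/

section Base

variable {k : Type} [Field k] [PerfectField k] {Y X V : Scheme.{0}} (f : Y ⟶ Spec (.of k))
  [LocallyOfFiniteType f] [QuasiCompact f] (i : X ⟶ Y) [IsClosedImmersion i] (q : X ⟶ V)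
  (g : V ⟶ Spec (.of k)) (hq : q ≫ g = i ≫ f) (hreg : Scheme.IsRegular X) {j : ℕ}
  (𝒜 : GradedAtlas j f i q)

include hq hreg 𝒜 in
/-- **From the slice core to étale quotient charts** (the base case of the cobordant-tower
induction, unpacked form of `stub_qs_base`). Given the slice-core statement `hcore` (for a
graded smooth `k`-algebra `R` with homogeneous units in all degrees `e • χ` and a maximal ideal
`P`: an étale `R₀`-algebra `S₀`, degree-`0` part of a finite-abelian-group-graded smooth
finite-type `k`-algebra `S`, with a prime over `P ∩ R₀`): if `X` is regular and
`𝒜 : GradedAtlas j f i q`, every `v ∈ V` lies in the image of an étale `k`-morphism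
`Spec S₀ ⟶ V` with such an `S`. Proof: `q` is surjective (`surjective`), so pick `x₁ ↦ v` and a
closed point `x₀ ∈ closure {x₁}` of the quasi-compact `X`; on the chart `a` of
`𝒜.exists_unit x₀` the ring `R = Γ(X, X ∩ W a)` is a graded smooth `k`-algebra (image grading
of `𝒜.piece a`; `X` regular over the perfect `k` ⇒ `X → Spec k` smooth,
`smooth_of_isRegular_of_perfectField`) with units in degrees `e • χ`; apply `hcore` at the
maximal ideal of `x₀` and set `φ := Spec S₀ → Spec R₀ ≅ Spec Γ(V, U a) ≅ U a ⊆ V`; it is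
étale, its (open) image contains `q x₀ ∈ closure {v}` hence `v`, and the structure maps agree
because `q ≫ g = i ≫ f`. [folklore; Włodarczyk arXiv:2203.03090 p. 3] -/
theorem exists_etale_quotientChart
    (hcore : ∀ {k : Type} [Field k] [PerfectField k] {R : Type} [CommRing R] [Algebra k R]
      {j : ℕ} (𝓡 : (Fin j → ℤ) → Submodule k R) [GradedAlgebra 𝓡] {e : ℕ}, 0 < e →
      (∀ χ : Fin j → ℤ, ∃ u ∈ 𝓡 (e • χ), IsUnit u) →
      ∀ (P : Ideal R) [P.IsMaximal] [Algebra.Smooth k R],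
      ∃ (A : Type) (_ : AddCommGroup A) (_ : Finite A) (_ : DecidableEq A) (S : Type)
        (_ : CommRing S) (_ : Algebra k S) (𝒮 : A → Submodule k S) (_ : GradedAlgebra 𝒮),
        Algebra.FiniteType k S ∧ Algebra.Smooth k S ∧
        ∃ (_ : Algebra (𝓡 0) (𝒮 0)) (_ : IsScalarTower k (𝓡 0) (𝒮 0))
          (_ : Algebra.Etale (𝓡 0) (𝒮 0)),
          ∃ t : Ideal (𝒮 0), t.IsPrime ∧
            ∀ r : 𝓡 0, algebraMap (𝓡 0) (𝒮 0) r ∈ t ↔ (r : R) ∈ P)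
    (v : V) :
    ∃ (A : Type) (_ : AddCommGroup A) (_ : Finite A) (_ : DecidableEq A)
      (S : Type) (_ : CommRing S) (_ : Algebra k S) (𝒮 : A → Submodule k S)
      (_ : GradedAlgebra 𝒮), Algebra.FiniteType k S ∧ Algebra.Smooth k S ∧
      ∃ φ : Spec (.of (𝒮 0)) ⟶ V, Etale φ ∧ v ∈ Set.range φ ∧
        φ ≫ g = Spec.map (CommRingCat.ofHom (algebraMap k (𝒮 0))) := by
  classical
  -- (1) a point `x₁ ↦ v` of `X` and a closed point `x₀` of `X` in its closure
  obtain ⟨x₁, hx₁⟩ := surjective 𝒜 v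
  haveI : CompactSpace X := QuasiCompact.compactSpace_of_compactSpace (i ≫ f)
  obtain ⟨x₀, hx₀₁, hx₀⟩ := (isClosed_closure (s := ({x₁} : Set X))).exists_closed_singleton
    ⟨x₁, subset_closure (Set.mem_singleton x₁)⟩
  have hspec : v ⤳ q x₀ := by
    rw [← hx₁]
    exact (specializes_iff_mem_closure.2 hx₀₁).map q.continuous
  -- (2) the chart of `x₀` with its homogeneous units
  obtain ⟨a, ha, hunit⟩ := 𝒜.exists_unit x₀
  have hU₀ : IsAffineOpen (i ⁻¹ᵁ (𝒜.W a : Y.Opens)) := Atlas.isAffineOpen_preimage_W 𝒜 a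
  have hx₀U : x₀ ∈ i ⁻¹ᵁ (𝒜.W a : Y.Opens) := ha
  -- (3) the graded `k`-algebra `R = Γ(X, X ∩ W a)`: structure map through `i ≫ f`, image grading
  letI := 𝒜.gradedRing a
  letI alg : Algebra k Γ(X, i ⁻¹ᵁ (𝒜.W a : Y.Opens)) :=
    ((i.app (𝒜.W a)).hom.comp
      ((Scheme.ΓSpecIso (.of k)).inv ≫ f.appLE ⊤ (𝒜.W a) le_top).hom).toAlgebra
  have hκ : ∀ c : k, ((Scheme.ΓSpecIso (.of k)).inv ≫ f.appLE ⊤ (𝒜.W a) le_top).hom c ∈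
      𝒜.piece a 0 := fun c => 𝒜.appLE_mem a _
  have halg : ∀ c : k, algebraMap k Γ(X, i ⁻¹ᵁ (𝒜.W a : Y.Opens)) c =
      (i.app (𝒜.W a)).hom (((Scheme.ΓSpecIso (.of k)).inv ≫ f.appLE ⊤ (𝒜.W a) le_top).hom c) :=
    fun c => rfl
  obtain ⟨𝓡, h𝓡⟩ := exists_submodule_mem_iff (𝒜.piece a) (i.app (𝒜.W a)).hom hκ halg
  letI : GradedAlgebra 𝓡 := Classical.choice (nonempty_gradedAlgebra_of_mem_iff (𝒜.piece a)
    (i.app (𝒜.W a)).hom 𝓡 h𝓡 (app_surjective 𝒜 a) (isHomogeneous_ker 𝒜 a))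
  have hunit' : ∀ χ : Fin j → ℤ, ∃ u ∈ 𝓡 (𝒜.exponent • χ), IsUnit u := fun χ => by
    obtain ⟨s, hs, hu⟩ := hunit χ
    exact ⟨_, (h𝓡 _ _).2 ⟨s, hs, rfl⟩, hu⟩
  -- `R` is smooth over `k`: `X` is regular and `k` is perfect
  haveI : Smooth (i ≫ f) := smooth_of_isRegular_of_perfectField (i ≫ f) hreg
  haveI : Algebra.Smooth k Γ(X, i ⁻¹ᵁ (𝒜.W a : Y.Opens)) := by
    have h := smooth_structureMap (i ≫ f) hU₀
    rw [← app_comp_structureMap] at h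
    exact h
  -- the maximal ideal of the closed point `x₀`
  haveI : (hU₀.primeIdealOf ⟨x₀, hx₀U⟩).asIdeal.IsMaximal :=
    hU₀.primeIdealOf_isMaximal_of_isClosed ⟨x₀, hx₀U⟩ hx₀
  -- (4) the slice core at `x₀`
  obtain ⟨A, _, _, _, S, _, _, 𝒮, _, hfin, hsm, _, _, _, t, ht, htP⟩ :=
    hcore 𝓡 𝒜.exponent_pos hunit' (hU₀.primeIdealOf ⟨x₀, hx₀U⟩).asIdeal
  -- (5) the comparison `τ : Γ(V, U a) ≅ R₀` and the chart `Spec S₀ → Spec R₀ ≅ U a ⊆ V`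
  have hψ0 : ∀ c, (q.appLE (𝒜.U a) (i ⁻¹ᵁ (𝒜.W a)) (𝒜.preimage_eq a).le).hom c ∈ 𝓡 0 :=
    fun c => (h𝓡 0 _).2 (appLE_mem_map 𝒜 a c)
  obtain ⟨τ, hτ⟩ := exists_ringHom_gradeZero 𝓡 hψ0
  have hbij : Function.Bijective τ :=
    bijective_of_coe_eq (fun x hx => exists_appLE_eq 𝒜 a x ((h𝓡 0 x).1 hx)) hτ
      (𝒜.appLE_injective a)
  haveI : Etale (Spec.map (CommRingCat.ofHom (algebraMap (𝓡 0) (𝒮 0)))) :=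
    (HasRingHomProperty.Spec_iff (P := @Etale)).mpr (RingHom.etale_algebraMap.mpr inferInstance)
  haveI : Etale (Spec.map (CommRingCat.ofHom τ)) :=
    (HasRingHomProperty.Spec_iff (P := @Etale)).mpr (RingHom.Etale.of_bijective hbij)
  refine ⟨A, ‹_›, ‹_›, ‹_›, S, ‹_›, ‹_›, 𝒮, ‹_›, hfin, hsm,
    Spec.map (CommRingCat.ofHom (algebraMap (𝓡 0) (𝒮 0))) ≫ Spec.map (CommRingCat.ofHom τ) ≫
      (𝒜.U a).2.fromSpec, inferInstance, ?_, ?_⟩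
  · -- `v ∈ range φ`: the range is open and contains `φ t = q x₀ ∈ closure {v}`
    refine hspec.mem_open (Scheme.Hom.isOpenMap _).isOpen_range ⟨⟨t, ht⟩, ?_⟩
    rw [Scheme.Hom.comp_apply, Scheme.Hom.comp_apply]
    refine fromSpec_eq_of_comap 𝒜 a hx₀U _ ?_
    change (t.comap (algebraMap (𝓡 0) (𝒮 0))).comap τ = _
    rw [← comap_comap_of_coe_eq hτ]
    congr 1
    ext r
    rw [Ideal.mem_comap, Ideal.mem_comap, htP]
    rfl
  · -- the structure maps to `Spec k` agree because `q ≫ g = i ≫ f`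
    rw [Category.assoc, Category.assoc, fromSpec_comp_eq g (𝒜.U a).2, ← Spec.map_comp,
      ← Spec.map_comp]
    congr 1
    refine CommRingCat.hom_ext (RingHom.ext fun c => ?_)
    change algebraMap (𝓡 0) (𝒮 0)
      (τ (((Scheme.ΓSpecIso (.of k)).inv ≫ g.appLE ⊤ (𝒜.U a) le_top).hom c)) =
      algebraMap k (𝒮 0) c
    rw [IsScalarTower.algebraMap_apply k (𝓡 0) (𝒮 0)]
    congr 1
    apply Subtype.ext
    rw [hτ, SetLike.GradeZero.coe_algebraMap, halg, ← RingHom.comp_apply, appLE_comp_structureMap,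
      hq, ← app_comp_structureMap]
    rfl

end Base

/-! ## Registered form -/

/-- **Stub `stub_qs_base`** of the line `Sketch` of the crux `DatumToEmbedded` (registered
signature): from the slice-core statement (the hypothesis, proved separately as
`stub_qs_sliceCore`), the quotient `V` of a regular `X` presented by a `GradedAtlas` is covered by
the images of étale `k`-morphisms `Spec S₀ ⟶ V` with `S` a smooth finite-type `k`-algebra graded
by a finite abelian group (`exists_etale_quotientChart`). [folklore; Włodarczyk arXiv:2203.03090
p. 3, "the geometric quotient has abelian quotient singularities"] -/
theorem stub_qs_base :
    (∀ {k : Type} [Field k] [PerfectField k] {R : Type} [CommRing R] [Algebra k R] {j : ℕ}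
      (𝓡 : (Fin j → ℤ) → Submodule k R) [GradedAlgebra 𝓡] {e : ℕ}, 0 < e →
      (∀ χ : Fin j → ℤ, ∃ u ∈ 𝓡 (e • χ), IsUnit u) →
      ∀ (P : Ideal R) [P.IsMaximal] [Algebra.Smooth k R],
      ∃ (A : Type) (_ : AddCommGroup A) (_ : Finite A) (_ : DecidableEq A) (S : Type)
        (_ : CommRing S) (_ : Algebra k S) (𝒮 : A → Submodule k S) (_ : GradedAlgebra 𝒮),
        Algebra.FiniteType k S ∧ Algebra.Smooth k S ∧
        ∃ (_ : Algebra (𝓡 0) (𝒮 0)) (_ : IsScalarTower k (𝓡 0) (𝒮 0))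
          (_ : Algebra.Etale (𝓡 0) (𝒮 0)),
          ∃ t : Ideal (𝒮 0), t.IsPrime ∧
            ∀ r : 𝓡 0, algebraMap (𝓡 0) (𝒮 0) r ∈ t ↔ (r : R) ∈ P) →
    ∀ {k : Type} [Field k] [PerfectField k] {Y X V : Scheme.{0}} (f : Y ⟶ Spec (.of k))
      [Smooth f] [IsSeparated f] [QuasiCompact f] (i : X ⟶ Y) [IsClosedImmersion i]
      (q : X ⟶ V) [IsIntegral V] (g : V ⟶ Spec (.of k)) [IsSeparated g] [LocallyOfFiniteType g]
      [QuasiCompact g], q ≫ g = i ≫ f → Scheme.IsRegular X →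
      ∀ {j : ℕ}, GradedAtlas j f i q →
      ∀ v : V, ∃ (A : Type) (_ : AddCommGroup A) (_ : Finite A) (_ : DecidableEq A)
          (S : Type) (_ : CommRing S) (_ : Algebra k S) (𝒮 : A → Submodule k S)
          (_ : GradedAlgebra 𝒮), Algebra.FiniteType k S ∧ Algebra.Smooth k S ∧
          ∃ φ : Spec (.of (𝒮 0)) ⟶ V, Etale φ ∧ v ∈ Set.range φ ∧
            φ ≫ g = Spec.map (CommRingCat.ofHom (algebraMap k (𝒮 0))) := by
  intro hcore k _ _ Y X V f _ _ _ i _ q _ g _ _ _ hq hreg j 𝒜 v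
  exact exists_etale_quotientChart f i q g hq hreg 𝒜 hcore v

end Summit.ResolutionOfSingularities.ResolutionOfSingularities.Theorems.DatumToEmbedded.QuotientBase

end
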